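/-
# PROBE 23 (pub-hlocus ivhs-2, ENGINE B gen 56) — THE TOTAL MULTIPLICITY OF A FIRST-BAND CELL of the unit-column rank drop

certified instances and evidence bearing on the general Hodge conjecture; no claim.

For a prime `p`, `c < p` and `k + c = 2p + r` with `r < 2c` (anchor 307's first band), PROBE 22 (`…UnitColumnRankDropBandProfile`, (PROFILE)
`rank_charP_add_sum_sum_eq_rank_charZero`) gives the characteristic-`p` rank deficit of anchor 229's multiplicity matrix of `×q^c` at EVERY level
`j` as the label count `Σ_{s ≤ r} Σ_{u ≤ r−s} C(k−s, min(u, r−s−u)) · #{μ : Fin k → Fin (e+1) : s non-zero coordinates, j + Σμ = (e+1)(p − c + s + u)}`.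
Here the profile is SUMMED OVER THE LEVELS: every label with `s` non-zero coordinates is counted at exactly one level ((LEV); `Σμ ≤ e·s` is
PROBE 22's (UB) `sum_label_le_mul_card_filter`) and there are `C(k,s)·e^s` of them ((CNT), by anchor 316's (PEEL) `sum_eq_sum_sum_cons`), so
  (TOTAL) `sum_rank_charP_add_eq_sum_rank_charZero` — HEADLINE: `Σ_{j=0}^{k(e+1)} rank_K(j) + Σ_{s=0}^{r} C(k,s)·e^s·Σ_{u=0}^{r−s} C(k−s, min(u, r−s−u))
          = Σ_{j=0}^{k(e+1)} rank_{K₀}(j)`  (K of characteristic p, K₀ of characteristic 0; the matrices VERBATIM from anchor 229);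
  (TOTAL₀) `sum_rank_charP_add_eq_sum_rank_charZero_zero` — `e = 0`: the total is `Σ_{u ≤ r} C(k, min(u, r−u))`.
The total `1, 2 + k·e, k + 2 + 2k·e + C(k,2)·e², …` (r = 0, 1, 2, …; a polynomial in `e` of degree `r`) is the total dimension of the kernel
directions the reduction mod `p` creates on the cell, all levels together; it recovers the totals of anchor 304 (r = 0: one drop of 1), anchor 307
(r = 1: the profile `1, k, …, k, 1` over the `e + 2` levels of the window sums to `2 + k·e`) and anchor 316 (r = 2).  Own numerics first
(`probe23/total_numerics.py`: the summation identity on 195 cells, 0 bad; the support counts (CNT) on 2 209 instances) and the ACTUAL ranks of the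
literal matrices at every level of 36 small cells summed per cell (`probe23/total_ranks.out`, 0 bad).  EVIDENCE CLASS: kernel theorems about the
census matrices; no census number changes; nothing here asserts anything about the Hodge conjecture.

Imports: PROBE 22's module `…Theorems.HodgeLocusCensusUnitColumnRankDropBandProfile` ((PROFILE), (UB)) and anchor 316
`…Theorems.HodgeLocusCensusUnitColumnRankDropThirdBoundary` ((PEEL)); hence 307, 304, 296, 294, 293, 230, 229.
-/
import Summits.HodgeConjecture.HodgeConjecture.Theorems.HodgeLocusCensusUnitColumnRankDropBandProfile
import Summits.HodgeConjecture.HodgeConjecture.Theorems.HodgeLocusCensusUnitColumnRankDropThirdBoundary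

set_option linter.dupNamespace false
set_option autoImplicit false

namespace Summit.HodgeConjecture.HodgeConjecture.HodgeLocus.Census.UnitColumnRankDropBandTotal

open Summit.HodgeConjecture.HodgeConjecture.HodgeLocus.Census.ModelNonJumpC1All (colR)
open Summit.HodgeConjecture.HodgeConjecture.HodgeLocus.Census.UnitColumnRankDropThirdBoundary (sum_eq_sum_sum_cons)
open Summit.HodgeConjecture.HodgeConjecture.HodgeLocus.Census.UnitColumnRankDropBandProfile (sum_label_le_mul_card_filter rank_charP_add_sum_sum_eq_rank_charZero)

/-! ## §1 COUNTING THE LABELS BY SUPPORT: `#{μ : Fin k → Fin (e+1) : exactly s non-zero coordinates} = C(k,s) · e^s` -/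

/-- (CNT) `#{μ : Fin k → Fin (e+1) : #{l : μ l ≠ 0} = s} = C(k,s) · e^s` (choose the support, then a value in `[1, e]` on each of its points;
induction on `k` by (PEEL) = anchor 316's `sum_eq_sum_sum_cons`: the first coordinate is `0` or one of `e` non-zero values, Pascal's rule). -/
theorem card_filter_card_eq_choose_mul_pow (k e s : ℕ) :
    (Finset.univ.filter (fun μ : Fin k → Fin (e + 1) => (Finset.univ.filter (fun l => (μ l : ℕ) ≠ 0)).card = s)).card = k.choose s * e ^ s := by
  induction k generalizing s with
  | zero =>
    cases s with
    | zero =>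
      rw [Nat.choose_zero_right, pow_zero, one_mul, Finset.card_eq_one]
      refine ⟨fun i => Fin.elim0 i, Finset.eq_singleton_iff_unique_mem.mpr ⟨?_, fun μ _ => funext (fun i => Fin.elim0 i)⟩⟩
      rw [Finset.mem_filter]
      exact ⟨Finset.mem_univ _, by rw [Finset.univ_eq_empty, Finset.filter_empty, Finset.card_empty]⟩
    | succ s =>
      rw [Nat.choose_zero_succ, zero_mul, Finset.card_eq_zero, Finset.filter_eq_empty_iff]
      intro μ _ h
      rw [Finset.univ_eq_empty, Finset.filter_empty, Finset.card_empty] at h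
      exact absurd h (by omega)
  | succ k ih =>
    have hcard : ∀ (x : Fin (e + 1)) (ν : Fin k → Fin (e + 1)),
        (Finset.univ.filter (fun l => ((Fin.cons x ν : Fin (k + 1) → Fin (e + 1)) l : ℕ) ≠ 0)).card =
          (if (x : ℕ) ≠ 0 then 1 else 0) + (Finset.univ.filter (fun l => (ν l : ℕ) ≠ 0)).card := fun x ν => by
      rw [Finset.card_filter, Finset.card_filter, Fin.sum_univ_succ]; rfl
    rw [Finset.card_filter, sum_eq_sum_sum_cons]
    simp only [hcard]
    rw [Fin.sum_univ_succ]
    simp only [Fin.val_zero, ne_eq, not_true_eq_false, if_false, zero_add, Fin.val_succ, Nat.add_one_ne_zero, not_false_eq_true, if_true]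
    rw [← Finset.card_filter, ih s]
    cases s with
    | zero =>
      simp only [show ∀ n : ℕ, ¬ (1 + n = 0) from fun n => by omega, if_false, Finset.sum_const_zero, add_zero, Nat.choose_zero_right]
    | succ s =>
      simp only [show ∀ n : ℕ, (1 + n = s + 1) ↔ (n = s) from fun n => by omega]
      rw [Finset.sum_congr rfl (fun (y : Fin e) _ => by rw [← Finset.card_filter, ih s]), Finset.sum_const, Finset.card_univ, Fintype.card_fin,
        smul_eq_mul, Nat.choose_succ_succ' k s]
      ring

/-! ## §2 SUMMING THE BAND PROFILE OVER THE LEVELS -/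

/-- (LEV) each label with `s` non-zero coordinates is counted at exactly one level: for `e·s ≤ A < B`,
`Σ_{j < B} #{μ : #{μ ≠ 0} = s ∧ j + Σμ = A} = #{μ : #{μ ≠ 0} = s} = C(k,s) · e^s` (`Σμ ≤ e·s ≤ A` by PROBE 22's (UB), so `j = A − Σμ < B`). -/
theorem sum_range_card_filter_eq (k e s A B : ℕ) (hA : e * s ≤ A) (hB : A < B) :
    (∑ j ∈ Finset.range B, (Finset.univ.filter (fun μ : Fin k → Fin (e + 1) => (Finset.univ.filter (fun l => (μ l : ℕ) ≠ 0)).card = s ∧ j + ∑ i, (μ i : ℕ) = A)).card) =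
      k.choose s * e ^ s := by
  have hL : ∀ j : ℕ, (Finset.univ.filter (fun μ : Fin k → Fin (e + 1) => (Finset.univ.filter (fun l => (μ l : ℕ) ≠ 0)).card = s ∧ j + ∑ i, (μ i : ℕ) = A)).card =
      ∑ μ : Fin k → Fin (e + 1), (if (Finset.univ.filter (fun l => (μ l : ℕ) ≠ 0)).card = s ∧ j + ∑ i, (μ i : ℕ) = A then 1 else 0) :=
    fun j => Finset.card_filter _ _
  rw [Finset.sum_congr rfl (fun j _ => hL j), ← card_filter_card_eq_choose_mul_pow k e s, Finset.card_filter, Finset.sum_comm]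
  refine Finset.sum_congr rfl (fun μ _ => ?_)
  by_cases hs : (Finset.univ.filter (fun l => (μ l : ℕ) ≠ 0)).card = s
  · have hle : (∑ i, (μ i : ℕ)) ≤ A := by
      have h := sum_label_le_mul_card_filter k e μ
      rw [hs] at h
      exact h.trans hA
    simp only [hs, true_and, if_true]
    rw [Finset.sum_congr rfl (fun j _ => show (if j + ∑ i, (μ i : ℕ) = A then 1 else 0) = (if j = A - ∑ i, (μ i : ℕ) then 1 else 0) by
          by_cases h : j + ∑ i, (μ i : ℕ) = A
          · rw [if_pos h, if_pos (by omega)]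
          · rw [if_neg h, if_neg (by omega)])]
    simp only [Finset.sum_ite_eq', Finset.mem_range, show A - ∑ i, (μ i : ℕ) < B by omega, if_true]
  · simp only [hs, false_and, if_false, Finset.sum_const_zero]

/-- (ΣPROFILE) THE BAND PROFILE SUMMED OVER ALL LEVELS `0 ≤ j ≤ k(e+1)`: for `c < p`, `k + c = 2p + r`,
`Σ_j Σ_{s ≤ r} Σ_{u ≤ r−s} C(k−s, min(u, r−s−u)) · #{μ : s non-zero coordinates, j + Σμ = (e+1)(p − c + s + u)}
 = Σ_{s ≤ r} C(k,s) · e^s · Σ_{u ≤ r−s} C(k−s, min(u, r−s−u))` ((LEV) with `A = (e+1)(p − c + s + u) ≤ (e+1)(k − p) < k(e+1) + 1`). -/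
theorem sum_range_sum_sum_eq (p k e c r : ℕ) (hcp : c < p) (hk : k + c = 2 * p + r) :
    (∑ j ∈ Finset.range (k * (e + 1) + 1),
        (∑ s ∈ Finset.range (r + 1), ∑ u ∈ Finset.range (r + 1 - s), (k - s).choose (min u (r - s - u)) *
          (Finset.univ.filter (fun μ : Fin k → Fin (e + 1) =>
            (Finset.univ.filter (fun l => (μ l : ℕ) ≠ 0)).card = s ∧ j + ∑ i, (μ i : ℕ) = (e + 1) * (p - c + s + u))).card)) =
      ∑ s ∈ Finset.range (r + 1), k.choose s * e ^ s * ∑ u ∈ Finset.range (r + 1 - s), (k - s).choose (min u (r - s - u)) := by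
  rw [Finset.sum_comm]
  refine Finset.sum_congr rfl (fun s hs => ?_)
  rw [Finset.mem_range] at hs
  rw [Finset.sum_comm, Finset.mul_sum]
  refine Finset.sum_congr rfl (fun u hu => ?_)
  rw [Finset.mem_range] at hu
  rw [← Finset.mul_sum, sum_range_card_filter_eq k e s ((e + 1) * (p - c + s + u)) (k * (e + 1) + 1) ?_ ?_]
  · ring
  · have h1 : e * s ≤ (e + 1) * s := Nat.mul_le_mul_right s (Nat.le_succ e)
    exact h1.trans (Nat.mul_le_mul_left (e + 1) (by omega))
  · have h2 : p - c + s + u ≤ k := by omega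
    have h3 : (e + 1) * (p - c + s + u) ≤ (e + 1) * k := Nat.mul_le_mul_left (e + 1) h2
    rw [Nat.mul_comm k (e + 1)]
    omega

/-! ## §3 THE TOTAL MULTIPLICITY OF A FIRST-BAND CELL -/

/-- **(TOTAL) THE TOTAL CHARACTERISTIC-`p` RANK DEFICIT OF `×q^c` OVER ALL LEVELS OF A FIRST-BAND CELL.** For a prime `p`, `c < p`,
`k + c = 2p + r` with `r < 2c` (anchor 307's first band `2p − c ≤ k < 2p + c`), a field `K` of characteristic `p` and a field `K₀` of
characteristic `0`, anchor 229's multiplicity matrices of `×q^c` on `K[x₁,…,x_k]/(xᵢ^{e+2})` (VERBATIM) satisfy, summed over all levels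
`0 ≤ j ≤ k(e+1)`:  `Σ_j rank_K(j) + Σ_{s=0}^{r} C(k,s) · e^s · Σ_{u=0}^{r−s} C(k−s, min(u, r−s−u)) = Σ_j rank_{K₀}(j)` — PROBE 22's band profile
(PROFILE) `rank_charP_add_sum_sum_eq_rank_charZero` summed by (ΣPROFILE). The total is a polynomial in `e` of degree `r`: `1` at `r = 0`
(anchor 304's single drop), `2 + k·e` at `r = 1` (anchor 307's `1, k, …, k, 1`), `k + 2 + 2k·e + C(k,2)·e²` at `r = 2` (anchor 316),
`Σ_{u ≤ r} C(k, min(u, r−u))` at `e = 0` ((TOTAL₀) below). -/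
theorem sum_rank_charP_add_eq_sum_rank_charZero (K K₀ : Type*) [Field K] [Field K₀] (p : ℕ) [CharP K p] [CharZero K₀] (hp : p.Prime)
    (k e c r : ℕ) (hcp : c < p) (hr : r < 2 * c) (hk : k + c = 2 * p + r) :
    (∑ j ∈ Finset.range (k * (e + 1) + 1),
        (Matrix.of fun (v : {v : Fin k → Fin (e + 2) // (∑ i, (v i : ℕ)) + j = k * (e + 1)})
          (m : {m : Fin k → Fin (e + 2) // (∑ i, (m i : ℕ)) + (j + c * (e + 1)) = k * (e + 1)}) =>
        ((((List.flatMap (colR (e + 3)))^[c] [List.ofFn (fun i => (m.1 i : ℕ))]).count (List.ofFn (fun i => (v.1 i : ℕ))) : ℕ) : K)).rank) +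
      ∑ s ∈ Finset.range (r + 1), k.choose s * e ^ s * ∑ u ∈ Finset.range (r + 1 - s), (k - s).choose (min u (r - s - u)) =
    ∑ j ∈ Finset.range (k * (e + 1) + 1),
        (Matrix.of fun (v : {v : Fin k → Fin (e + 2) // (∑ i, (v i : ℕ)) + j = k * (e + 1)})
          (m : {m : Fin k → Fin (e + 2) // (∑ i, (m i : ℕ)) + (j + c * (e + 1)) = k * (e + 1)}) =>
        ((((List.flatMap (colR (e + 3)))^[c] [List.ofFn (fun i => (m.1 i : ℕ))]).count (List.ofFn (fun i => (v.1 i : ℕ))) : ℕ) : K₀)).rank := by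
  rw [← sum_range_sum_sum_eq p k e c r hcp hk, ← Finset.sum_add_distrib]
  exact Finset.sum_congr rfl (fun j _ => rank_charP_add_sum_sum_eq_rank_charZero K K₀ p hp k e c j r hcp hr hk)

/-- (TOTAL₀) the square-free truncation `e = 0` (one label, `xᵢ² = 0`): the total deficit over all levels `0 ≤ j ≤ k` is the folded Pascal
row summed, `Σ_{u=0}^{r} C(k, min(u, r−u))` (`c < p`, `r < 2c`, `k + c = 2p + r`). -/
theorem sum_rank_charP_add_eq_sum_rank_charZero_zero (K K₀ : Type*) [Field K] [Field K₀] (p : ℕ) [CharP K p] [CharZero K₀] (hp : p.Prime)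
    (k c r : ℕ) (hcp : c < p) (hr : r < 2 * c) (hk : k + c = 2 * p + r) :
    (∑ j ∈ Finset.range (k * (0 + 1) + 1),
        (Matrix.of fun (v : {v : Fin k → Fin (0 + 2) // (∑ i, (v i : ℕ)) + j = k * (0 + 1)})
          (m : {m : Fin k → Fin (0 + 2) // (∑ i, (m i : ℕ)) + (j + c * (0 + 1)) = k * (0 + 1)}) =>
        ((((List.flatMap (colR (0 + 3)))^[c] [List.ofFn (fun i => (m.1 i : ℕ))]).count (List.ofFn (fun i => (v.1 i : ℕ))) : ℕ) : K)).rank) +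
      ∑ u ∈ Finset.range (r + 1), k.choose (min u (r - u)) =
    ∑ j ∈ Finset.range (k * (0 + 1) + 1),
        (Matrix.of fun (v : {v : Fin k → Fin (0 + 2) // (∑ i, (v i : ℕ)) + j = k * (0 + 1)})
          (m : {m : Fin k → Fin (0 + 2) // (∑ i, (m i : ℕ)) + (j + c * (0 + 1)) = k * (0 + 1)}) =>
        ((((List.flatMap (colR (0 + 3)))^[c] [List.ofFn (fun i => (m.1 i : ℕ))]).count (List.ofFn (fun i => (v.1 i : ℕ))) : ℕ) : K₀)).rank := by
  have h0 : (∑ s ∈ Finset.range (r + 1), k.choose s * 0 ^ s * ∑ u ∈ Finset.range (r + 1 - s), (k - s).choose (min u (r - s - u))) =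
      ∑ u ∈ Finset.range (r + 1), k.choose (min u (r - u)) := by
    rw [Finset.sum_range_succ']
    simp only [pow_succ, mul_zero, zero_mul, Finset.sum_const_zero, zero_add, pow_zero, Nat.choose_zero_right, one_mul, Nat.sub_zero]
  rw [← h0]
  exact sum_rank_charP_add_eq_sum_rank_charZero K K₀ p hp k 0 c r hcp hr hk

end Summit.HodgeConjecture.HodgeConjecture.HodgeLocus.Census.UnitColumnRankDropBandTotal
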